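import Literature.Geometry.Lorentzian.InverseMeanCurvatureFlowChaining
import Literature.Geometry.Lorentzian.InverseMeanCurvatureFlowMetricLocality
import HarnessLib

/-!
# Inverse mean curvature flow I — proofs: the exterior solution from regularised Dirichlet
# solutions for the modified metrics `g_L` (Huisken–Ilmanen, proof of Thm. 3.1, step 2)

`InverseMeanCurvatureFlowExteriorExistence.lean` reduces the named fact `weak_existence`
(Huisken–Ilmanen, J. Differential Geom. 59 (2001), Thm. 3.1) to the analytic output of
Lemmas 3.4–3.5 *for the given metric* `h` on an exhaustion `U_L`. For a general (merely locally
Lipschitz) subsolution `v` at infinity, however, the printed proof (step 2, p. 27) solves the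
regularised problems for *modified* complete metrics `g_L` on `U_L ⊇ F̄_L`, with "`g_L = g` on
`F_L`, `g_L ≥ g` on all of `U_L`", conic near `∂U_L` so that a smooth subsolution is available
there, and compares with `min(v, L)`, "a weak subsolution … with respect to the metric `g_L`".
This file provides the assembly in that form:

* `exists_nhds_forall_lipschitzOnWith_of_metric` — **Lipschitz bounds pass between the distances
  of two Riemannian metrics, locally and uniformly in the function** (both distances are locally
  bi-Lipschitz to a chart distance; cf. `IsLocLipschitzOn.of_metric` of
  `InverseMeanCurvatureFlowMetricLocality.lean`, here with explicit constants);
* `exists_isWeakSolution_ge_of_regularised_dirichlet'` — the fixed-`L` limit `ε → 0` of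
  `InverseMeanCurvatureFlowExteriorAssembly.lean` with the comparison function entering only as
  "`min(v, b)` is a weak subsolution on `X ∖ F̄₀` for the metric at hand";
* `exterior_existence_of_regularised_dirichlet_solutions_metric` — **the limit `L → ∞` for a
  family of metrics `g_L = h` on `{v < c_L}`, `c_L → ∞`**: solutions of (⋆)_ε for `g_L` with the
  estimates of Lemma 3.4 yield an exterior solution for `h` (transfer by
  `IsWeakSolution.of_metric`, `gradNorm_congr_of_inner_eq`);
* `weak_existence_of_regularised_dirichlet_solutions_metric` — **the named fact from the
  step-2 package**: for every datum, metrics `g_L ≥ h` with `g_L = h` on `{v < c_L}` and the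
  regularised Dirichlet solutions for `g_L` with their estimates imply `weak_existence`
  (`min(v, c_L)` is a `g_L`-subsolution by `IsWeakSubsolutionIVP.inf_const_of_metric_le`;
  pointwise bounds by chaining, `exists_forall_abs_le_of_lipschitz_chain`; then
  `weak_existence_of_exterior_existence`).

Everything is proved; there are no definitions and no named facts.

## References

* G. Huisken, T. Ilmanen, *The inverse mean curvature flow and the Riemannian Penrose
  inequality*, J. Differential Geom. 59 (2001) 353–437: §3, proof of Thm. 3.1, step 2
  (metrics `g_L`, "`min(v, L)` remains a weak subsolution … with respect to `g_L`",
  "Passing `L → ∞`").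
* D. Burago, Yu. Burago, S. Ivanov, *A course in metric geometry*, AMS 2001, §5.1.
-/

noncomputable section

open Bundle Set Manifold TopologicalSpace Filter MeasureTheory Function
open scoped ContDiff Topology ENNReal NNReal Manifold Real

namespace Literature.Geometry.Lorentzian

open PseudoRiemannianMetric

variable {X : Type*} [TopologicalSpace X] [ChartedSpace E3 X] [IsManifold (𝓡 3) ∞ X]
  (h : ContMDiffRiemannianMetric (𝓡 3) ∞ E3 (TangentSpace (𝓡 3) : X → Type _))
  [T2Space X] [LocallyCompactSpace X]

/-! ### Lipschitz bounds for two metrics -/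

set_option backward.isDefEq.respectTransparency false in
/-- **Lipschitz bounds pass between the distances of two Riemannian metrics, locally, with a
constant independent of the function.** For smooth Riemannian metrics `h, h'` on `X` and a point
`x` there are a neighbourhood `U` of `x` and `c` such that every function `K`-Lipschitz on a
subset `t ⊆ U` for the distance of `h` is `(K c)`-Lipschitz on `t` for the distance of `h'`
(`d_h ≤ 2 ‖A(φ· − φ·)‖ ≤ 2‖A ∘ A'⁻¹‖ ‖A'(φ· − φ·)‖ ≤ 4 ‖A ∘ A'⁻¹‖ d_{h'}` near `x`,
`exists_nhds_riemannianEDist_le_and_edist_le`). [folklore] -/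
theorem exists_nhds_forall_lipschitzOnWith_of_metric
    (h' : ContMDiffRiemannianMetric (𝓡 3) ∞ E3 (TangentSpace (𝓡 3) : X → Type _)) (x : X) :
    ∃ U ∈ 𝓝 x, ∃ c : ℝ≥0, ∀ (f : X → ℝ) (K : ℝ≥0) (t : Set X), t ⊆ U →
      (letI : RiemannianBundle (fun x : X ↦ TangentSpace (𝓡 3) x) :=
          ⟨h.toContinuousRiemannianMetric.toRiemannianMetric⟩;
        letI : PseudoEMetricSpace X := .ofRiemannianMetric (𝓡 3) X;
        LipschitzOnWith K f t) →
      (letI : RiemannianBundle (fun x : X ↦ TangentSpace (𝓡 3) x) :=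
          ⟨h'.toContinuousRiemannianMetric.toRiemannianMetric⟩;
        letI : PseudoEMetricSpace X := .ofRiemannianMetric (𝓡 3) X;
        LipschitzOnWith (K * c) f t) := by
  -- for `h`: `d_h ≤ 2 ‖A(φ· − φ·)‖` near `x`
  obtain ⟨A, U, hU, hle⟩ : ∃ (A : E3 →L[ℝ] E3) (U : Set X), U ∈ 𝓝 x ∧
      letI : RiemannianBundle (fun x : X ↦ TangentSpace (𝓡 3) x) :=
        ⟨h.toContinuousRiemannianMetric.toRiemannianMetric⟩
      letI : PseudoEMetricSpace X := .ofRiemannianMetric (𝓡 3) X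
      ∀ q ∈ U, ∀ q' ∈ U, edist q q' ≤
        (2 : ℝ≥0) * edist (A (extChartAt (𝓡 3) x q)) (A (extChartAt (𝓡 3) x q')) := by
    letI : RiemannianBundle (fun x : X ↦ TangentSpace (𝓡 3) x) :=
      ⟨h.toContinuousRiemannianMetric.toRiemannianMetric⟩
    letI : PseudoEMetricSpace X := .ofRiemannianMetric (𝓡 3) X
    obtain ⟨A, hA⟩ := exists_norm_eq_norm_symmL (I := 𝓡 3) x x
    obtain ⟨U, hU, -, hle, -⟩ :=
      exists_nhds_riemannianEDist_le_and_edist_le (I := 𝓡 3) x x (mem_chart_source E3 x) hA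
        one_lt_two
    exact ⟨A, U, hU, fun q hq q' hq' ↦ hle q hq q' hq'⟩
  -- for `h'`: `‖A'(φ· − φ·)‖ ≤ 2 d_{h'}` near `x`, `A'` invertible
  letI : RiemannianBundle (fun x : X ↦ TangentSpace (𝓡 3) x) :=
    ⟨h'.toContinuousRiemannianMetric.toRiemannianMetric⟩
  letI : PseudoEMetricSpace X := .ofRiemannianMetric (𝓡 3) X
  obtain ⟨A', hA'⟩ := exists_norm_eq_norm_symmL (I := 𝓡 3) x x
  obtain ⟨Ae, hAe⟩ :=
    exists_continuousLinearEquiv_of_norm_eq_norm_symmL (I := 𝓡 3) x x (mem_chart_source E3 x) hA'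
  obtain ⟨U', hU', -, -, hge⟩ :=
    exists_nhds_riemannianEDist_le_and_edist_le (I := 𝓡 3) x x (mem_chart_source E3 x) hA'
      one_lt_two
  set B : E3 →L[ℝ] E3 := A.comp (Ae.symm : E3 →L[ℝ] E3) with hB
  have hAB : ∀ z, A z = B (A' z) := fun z ↦ by
    rw [hB, ← hAe z]
    simp
  refine ⟨U ∩ U', inter_mem hU hU', 2 * (‖B‖₊ * 2), fun f K t htU hf ↦ ?_⟩
  intro q hq q' hq'
  have h1 := hf hq hq'
  calc edist (f q) (f q')
      ≤ K * ((2 : ℝ≥0) * edist (A (extChartAt (𝓡 3) x q)) (A (extChartAt (𝓡 3) x q'))) :=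
        h1.trans (by gcongr; exact hle q (htU hq).1 q' (htU hq').1)
    _ = K * ((2 : ℝ≥0) * edist (B (A' (extChartAt (𝓡 3) x q))) (B (A' (extChartAt (𝓡 3) x q')))) := by
        rw [hAB, hAB]
    _ ≤ K * ((2 : ℝ≥0) * (‖B‖₊ * edist (A' (extChartAt (𝓡 3) x q)) (A' (extChartAt (𝓡 3) x q')))) := by
        gcongr
        exact B.lipschitz.edist_le_mul _ _
    _ ≤ K * ((2 : ℝ≥0) * (‖B‖₊ * ((2 : ℝ≥0) * edist q q'))) := by
        gcongr
        exact hge q (htU hq).2 q' (htU hq').2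
    _ = ((K * (2 * (‖B‖₊ * 2)) : ℝ≥0) : ℝ≥0∞) * edist q q' := by push_cast; ring

/-! ### The limit `ε → 0` at fixed `L`, general comparison function -/

variable [MeasurableSpace X] [BorelSpace X] [SecondCountableTopology X]
  [ConnectedSpace X] [NoncompactSpace X]

variable [(ofRiemannian h).HasLeviCivita]

set_option backward.isDefEq.respectTransparency false in
/-- **From regularised Dirichlet solutions to a weak solution above the subsolution**, general
comparison function (as `exists_isWeakSolution_ge_of_regularised_dirichlet`, the subsolution
entering only through the hypotheses actually used: `v` continuous, `F₀ = {v < 0}`, and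
`min(v, b)` a weak subsolution of (∗∗) on `X ∖ F̄₀` *for the metric of the statement* — so that
the theorem applies on `(X, g_L)` with H–I's comparison function `min(v, L)`, a subsolution for the
modified metric `g_L` by `IsWeakSubsolutionIVP.inf_const_of_metric_le`). The limit `ε → 0` at
fixed `L` in Huisken–Ilmanen's proof of Thm. 3.1, with the lower bound of step 2 obtained by
interior comparison. Data: `E₀` open with `Ē₀ ⊆ U`, `U` open, `Ω = U ∖ Ē₀`; a weak
subsolution `v` of (††) with initial condition `F₀ ⊇ Ē₀`; classical solutions `w_k ∈ C²(X)` of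
(⋆)_{ε_k} on `Ω` (`ψ_k Δw_k − h⁻¹(dψ_k, dw_k) = ψ_k³`, `ψ_k = √(|∇w_k|² + ε_k²) ∈ C¹(Ω)`),
`ε_k > 0`, `ε_k → 0`, with: local gradient bounds on `Ω` uniform in `k`; uniform Lipschitz bounds
near the points of `∂E₀` on relative neighbourhoods in `X ∖ E₀`; `w_k = 0` on `∂E₀`;
`w_k ≥ −η_k` on `U ∖ E₀` with `η_k → 0`; pointwise upper bounds on `U ∖ E₀`; and for every `δ > 0`
a compact `C ⊆ U` off which `w_k ≥ b − δ` on `U` (all `k`). Conclusion: a subsequence converges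
locally uniformly on `U ∖ E₀` to a function `u` which is a weak solution of (1.5) on `Ω`, vanishes
on `∂E₀`, is `≥ 0` on `U ∖ E₀`, and satisfies `u ≥ min(v, b)` on `Ω`.
[cite: HuiskenIlmanenIMCF2001, §3 proof of Thm. 3.1 (steps 1–2) with Lemmas 3.4–3.5 as input] -/
theorem exists_isWeakSolution_ge_of_regularised_dirichlet' {E₀ U F₀ : Set X} (hE₀ : IsOpen E₀)
    (hU : IsOpen U) (hE₀U : closure E₀ ⊆ U) {v : X → ℝ} (hvc : Continuous v)
    (hF₀eq : F₀ = {x | v x < 0}) {b : ℝ}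
    (hvsub : IsWeakSubsolution h (fun x ↦ min (v x) b) (closure F₀)ᶜ)
    (hE₀F₀ : closure E₀ ⊆ F₀) {w : ℕ → X → ℝ} {ε : ℕ → ℝ} {ψ : ℕ → X → ℝ} {η : ℕ → ℝ}
    (hw : ∀ k, ContMDiff (𝓡 3) 𝓘(ℝ, ℝ) 2 (w k)) (hε : ∀ k, 0 < ε k)
    (hε0 : Tendsto ε atTop (𝓝 0))
    (hψ : ∀ k x, ψ k x = Real.sqrt (gradNorm h (w k) x ^ 2 + ε k ^ 2))
    (hψ1 : ∀ k, ContMDiffOn (𝓡 3) 𝓘(ℝ, ℝ) 1 (ψ k) (U \ closure E₀))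
    (hpde : ∀ k, ∀ x ∈ U \ closure E₀, ψ k x * (ofRiemannian h).dalembertian (w k) x -
      (ofRiemannian h).innerDual x (mvfderiv (𝓡 3) (ψ k) x).toLinearMap
        (mvfderiv (𝓡 3) (w k) x).toLinearMap = ψ k x ^ 3)
    (hgrad : ∀ x ∈ U \ closure E₀, ∃ C : ℝ≥0, ∃ V ∈ 𝓝 x, ∀ k, ∀ q ∈ V, gradNorm h (w k) q ≤ C)
    (hblip : letI : RiemannianBundle (fun x : X ↦ TangentSpace (𝓡 3) x) :=
        ⟨h.toContinuousRiemannianMetric.toRiemannianMetric⟩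
      letI : PseudoEMetricSpace X := .ofRiemannianMetric (𝓡 3) X
      ∀ x ∈ frontier E₀, ∃ K : ℝ≥0, ∃ V ∈ 𝓝 x, ∀ k, LipschitzOnWith K (w k) (V ∩ E₀ᶜ))
    (hzero : ∀ k, ∀ x ∈ frontier E₀, w k x = 0)
    (hη : Tendsto η atTop (𝓝 0)) (hlow : ∀ k, ∀ x ∈ U, x ∉ E₀ → -η k ≤ w k x)
    (hup : ∀ x ∈ U, x ∉ E₀ → ∃ B : ℝ, ∀ k, w k x ≤ B)
    (hbar : ∀ δ : ℝ, 0 < δ → ∃ C : Set X, IsCompact C ∧ C ⊆ U ∧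
      ∀ k, ∀ x ∈ U, x ∉ C → b - δ ≤ w k x) :
    ∃ (u : X → ℝ) (φ : ℕ → ℕ), StrictMono φ ∧
      TendstoLocallyUniformlyOn (fun n ↦ w (φ n)) u atTop (U ∩ E₀ᶜ) ∧
      IsWeakSolution h u (U \ closure E₀) ∧ (∀ x ∈ frontier E₀, u x = 0) ∧
      (∀ x ∈ U, x ∉ E₀ → 0 ≤ u x) ∧ ∀ x ∈ U \ closure E₀, min (v x) b ≤ u x := by
  classical
  letI : RiemannianBundle (fun x : X ↦ TangentSpace (𝓡 3) x) :=
    ⟨h.toContinuousRiemannianMetric.toRiemannianMetric⟩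
  letI : PseudoEMetricSpace X := .ofRiemannianMetric (𝓡 3) X
  set Ω : Set X := U \ closure E₀ with hΩdef
  have hΩo : IsOpen Ω := hU.sdiff isClosed_closure
  have hfront : frontier E₀ = closure E₀ \ E₀ := by
    rw [frontier, hE₀.interior_eq]
  -- `U ∩ E₀ᶜ = Ω ∪ ∂E₀`
  have hdecomp : ∀ x ∈ U, x ∉ E₀ → x ∈ Ω ∨ x ∈ frontier E₀ := fun x hxU hxE ↦ by
    by_cases hxc : x ∈ closure E₀
    · exact Or.inr (hfront ▸ ⟨hxc, hxE⟩)
    · exact Or.inl ⟨hxU, hxc⟩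
  have hfrontU : frontier E₀ ⊆ U := fun x hx ↦ hE₀U (frontier_subset_closure hx)
  have hfrontE : ∀ x ∈ frontier E₀, x ∉ E₀ := fun x hx ↦ (hfront ▸ hx).2
  -- (1) equi-Lipschitz in `k` near every point of `Ω` (gradient bounds)
  have hlipΩ : ∀ x ∈ Ω, ∃ K : ℝ≥0, ∃ V ∈ 𝓝 x, ∀ k, LipschitzOnWith K (w k) V := by
    intro x hx
    obtain ⟨C, V, hV, hC⟩ := hgrad x hx
    obtain ⟨W, hW, hWV, c, hc⟩ := exists_nhds_subset_forall_lipschitzOnWith_of_gradNorm_le h x hV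
    exact ⟨C * c, W, hW, fun k ↦ hc (w k) C
      (fun q _ ↦ ((hw k).of_le (by norm_num)).mdifferentiableAt one_ne_zero)
      fun q hq ↦ hC k q (hWV hq)⟩
  -- (2) Arzelà–Ascoli on `Ω`
  have hbddΩ : ∀ x ∈ Ω, ∃ B : ℝ, ∀ k, |w k x| ≤ B := by
    intro x hx
    have hxE : x ∉ E₀ := fun h' ↦ hx.2 (subset_closure h')
    obtain ⟨B, hB⟩ := hup x hx.1 hxE
    obtain ⟨B', hB'⟩ : ∃ B', ∀ k, -B' ≤ w k x := by
      obtain ⟨M, hM⟩ := hη.bddAbove_range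
      refine ⟨max M 0, fun k ↦ ?_⟩
      have h1 := hlow k x hx.1 hxE
      have h2 : η k ≤ M := hM ⟨k, rfl⟩
      linarith [le_max_left M 0]
    exact ⟨max B B', fun k ↦ abs_le.2 ⟨by linarith [hB' k, le_max_right B B'],
      (hB k).trans (le_max_left _ _)⟩⟩
  obtain ⟨φ, u₀, hφ, hconvΩ⟩ :=
    exists_strictMono_tendstoLocallyUniformlyOn_of_lipschitzOnWith h hΩo hlipΩ hbddΩ
  -- the limit function: `u₀` on `Ω`, `0` elsewhere
  set u : X → ℝ := fun x ↦ if x ∈ Ω then u₀ x else 0 with hudef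
  have huΩ : ∀ x ∈ Ω, u x = u₀ x := fun x hx ↦ by simp only [hudef, if_pos hx]
  have hu0 : ∀ x ∈ frontier E₀, u x = 0 := fun x hx ↦ by
    have : x ∉ Ω := fun h' ↦ h'.2 (frontier_subset_closure hx)
    simp only [hudef, if_neg this]
  have hconvΩ' : TendstoLocallyUniformlyOn (fun n ↦ w (φ n)) u atTop Ω := by
    refine hconvΩ.congr_right fun x hx ↦ (huΩ x hx).symm
  have hptΩ : ∀ x ∈ Ω, Tendsto (fun n ↦ w (φ n) x) atTop (𝓝 (u x)) := fun x hx ↦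
    hconvΩ'.tendsto_at hx
  -- (3) convergence on `U ∩ E₀ᶜ` (anchored at `∂E₀`)
  have hpt : ∀ y ∈ U ∩ E₀ᶜ, Tendsto (fun n ↦ w (φ n) y) atTop (𝓝 (u y)) := by
    intro y hy
    rcases hdecomp y hy.1 hy.2 with hyΩ | hyf
    · exact hptΩ y hyΩ
    · rw [hu0 y hyf]
      exact tendsto_const_nhds.congr fun n ↦ (hzero (φ n) y hyf).symm
  have hconv : TendstoLocallyUniformlyOn (fun n ↦ w (φ n)) u atTop (U ∩ E₀ᶜ) := by
    refine tendstoLocallyUniformlyOn_of_anchored h hΩo hconvΩ' hpt fun x hx hxΩ ↦ ?_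
    have hxf : x ∈ frontier E₀ := (hdecomp x hx.1 hx.2).resolve_left hxΩ
    refine ⟨fun k ↦ by rw [hzero (φ k) x hxf, hu0 x hxf], ?_⟩
    obtain ⟨K, V, hV, hK⟩ := hblip x hxf
    exact ⟨K, V, hV, fun k ↦ (hK (φ k)).mono fun y hy ↦ ⟨hy.1, hy.2.2⟩⟩
  -- (4) `u` is a weak solution on `Ω`
  have hsol : IsWeakSolution h u Ω := by
    refine isWeakSolution_of_regularised_limit h hΩo (fun _ ↦ hΩo) (fun n ↦ hw (φ n))
      (fun n ↦ hε (φ n)) (hε0.comp hφ.tendsto_atTop) (fun n x ↦ hψ (φ n) x)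
      (fun n ↦ hψ1 (φ n)) (fun n ↦ hpde (φ n)) (fun K _ hKΩ ↦ Eventually.of_forall fun _ ↦ hKΩ)
      hconvΩ' fun x hx ↦ ?_
    obtain ⟨C, V, hV, hC⟩ := hgrad x hx
    exact ⟨C, V, hV, Eventually.of_forall fun n q hq ↦ hC (φ n) q hq⟩
  -- (5) sign and lower barrier in the limit
  have hnonneg : ∀ x ∈ U, x ∉ E₀ → 0 ≤ u x := by
    intro x hxU hxE
    have hlim := hpt x ⟨hxU, hxE⟩
    have hηφ : Tendsto (fun n ↦ -η (φ n)) atTop (𝓝 0) := by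
      simpa using (hη.comp hφ.tendsto_atTop).neg
    exact le_of_tendsto_of_tendsto' hηφ hlim fun n ↦ hlow (φ n) x hxU hxE
  have hbar' : ∀ δ : ℝ, 0 < δ → ∃ C : Set X, IsCompact C ∧ C ⊆ U ∧
      ∀ x ∈ U, x ∉ E₀ → x ∉ C → b - δ ≤ u x := by
    intro δ hδ
    obtain ⟨C, hC, hCU, hCb⟩ := hbar δ hδ
    refine ⟨C, hC, hCU, fun x hxU hxE hxC ↦ ?_⟩
    exact ge_of_tendsto (hpt x ⟨hxU, hxE⟩) (Eventually.of_forall fun n ↦ hCb (φ n) x hxU hxC)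
  -- (6) the lower bound `u ≥ min(v, b)` by interior comparison on `U ∖ F̄₀`
  have hvF : ∀ x ∈ closure F₀, v x ≤ 0 := by
    rw [hF₀eq]
    exact fun x hx ↦ closure_lt_subset_le hvc continuous_const hx
  set Ω' : Set X := U \ closure F₀ with hΩ'def
  have hΩ'o : IsOpen Ω' := hU.sdiff isClosed_closure
  have hΩ'Ω : Ω' ⊆ Ω := fun x hx ↦ ⟨hx.1, fun h' ↦ hx.2 (closure_mono hE₀F₀ (by
    rwa [closure_closure]))⟩
  have hsub : IsWeakSubsolution h (fun x ↦ min (v x) b) Ω' :=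
    hvsub.mono h hΩ'o fun x hx ↦ hx.2
  have hsup : IsWeakSupersolution h u Ω' :=
    ((isWeakSolution_iff_sub_and_super h hΩ'o).1 (hsol.mono h hΩ'o hΩ'Ω)).2
  have hcomp : ∀ x ∈ Ω', min (v x) b ≤ u x := by
    refine hsup.le_of_isWeakSubsolution_of_forall_pos h hsub hΩ'o fun δ hδ ↦ ?_
    obtain ⟨C, hC, hCU, hCb⟩ := hbar' δ hδ
    refine ⟨C ∩ {x | δ ≤ v x}, hC.inter_right (isClosed_le continuous_const hvc), ?_, ?_⟩
    · rintro x ⟨hxC, hxv⟩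
      refine ⟨hCU hxC, fun hxF ↦ ?_⟩
      have := hvF x hxF
      simp only [mem_setOf_eq] at hxv
      linarith
    · rintro x ⟨hxΩ', hlt⟩
      have hxU : x ∈ U := hxΩ'.1
      have hxE : x ∉ E₀ := fun h' ↦ (hΩ'Ω hxΩ').2 (subset_closure h')
      have hux : 0 ≤ u x := hnonneg x hxU hxE
      refine ⟨by_contra fun hxC ↦ ?_, ?_⟩
      · have := hCb x hxU hxE hxC
        have : min (v x) b ≤ b := min_le_right _ _
        linarith
      · simp only [mem_setOf_eq]
        have : min (v x) b ≤ v x := min_le_left _ _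
        linarith
  have hge : ∀ x ∈ Ω, min (v x) b ≤ u x := by
    intro x hx
    by_cases hxF : x ∈ closure F₀
    · have hxE : x ∉ E₀ := fun h' ↦ hx.2 (subset_closure h')
      exact (min_le_left _ _).trans ((hvF x hxF).trans (hnonneg x hx.1 hxE))
    · exact hcomp x ⟨hx.1, hxF⟩
  exact ⟨u, φ, hφ, hconv, hsol, hu0, hnonneg, hge⟩


/-! ### The limit `L → ∞` for a family of metrics -/

omit [(ofRiemannian h).HasLeviCivita] in
set_option backward.isDefEq.respectTransparency false in
/-- **The exterior solution from regularised Dirichlet solutions for modified metrics** (the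
faithful form of Huisken–Ilmanen's step 2: for each `L` the regularised problems are solved for a
metric `g_L` with `g_L = h` on `{v < c_L}`, `c_L → ∞`, and the comparison function is
`min(v, c_L)`, a weak subsolution for `g_L` — `IsWeakSubsolutionIVP.inf_const_of_metric_le` when
`g_L ≥ h`). Hypotheses as in `exterior_existence_of_regularised_dirichlet_solutions`, the equation
(⋆)_ε, its slope `ψ` and the gradient bounds being those of `g_L`, the boundary Lipschitz bounds
those of `h`; conclusion for `h`: an exterior solution in the sense of
`weak_existence_of_exterior_existence`. The solutions for `g_L` are solutions for `h` on
`{v < c_L}` (`IsWeakSolution.of_metric`), the slopes agree there (`gradNorm_congr_of_inner_eq`),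
and Lipschitz bounds for `d_h` are Lipschitz bounds for `d_{g_L}` near each point
(`exists_nhds_forall_lipschitzOnWith_of_metric`).
[cite: HuiskenIlmanenIMCF2001, §3 proof of Thm. 3.1, step 2] -/
theorem exterior_existence_of_regularised_dirichlet_solutions_metric {E₀ F₀ : Set X}
    (hE₀ : IsOpen E₀) {v : X → ℝ} (hv : IsWeakSubsolutionIVP h v F₀) (hvp : IsProperFun v)
    (hF₀ : IsCompact (closure F₀)) (hE₀F₀ : closure E₀ ⊆ F₀)
    (g : ℕ → ContMDiffRiemannianMetric (𝓡 3) ∞ E3 (TangentSpace (𝓡 3) : X → Type _))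
    [hLC : ∀ L, (ofRiemannian (g L)).HasLeviCivita] {c : ℕ → ℝ} (hc0 : ∀ L, 0 ≤ c L)
    (hc : Tendsto c atTop atTop) (hagree : ∀ L x, v x < c L → (g L).inner x = h.inner x)
    (hsubL : ∀ L, IsWeakSubsolution (g L) (fun x ↦ min (v x) (c L)) (closure F₀)ᶜ)
    {U : ℕ → Set X} (hUo : ∀ L, IsOpen (U L)) (hE₀U : ∀ L, closure E₀ ⊆ U L)
    (hUmono : ∀ L M : ℕ, L ≤ M → U L ⊆ U M) (hexh : ∀ K : Set X, IsCompact K → ∃ L, K ⊆ U L)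
    {w : ℕ → ℕ → X → ℝ} {ε : ℕ → ℕ → ℝ} {ψ : ℕ → ℕ → X → ℝ} {η : ℕ → ℕ → ℝ} {b : ℕ → ℝ}
    (hb : Tendsto b atTop atTop)
    (hw : ∀ L k, ContMDiff (𝓡 3) 𝓘(ℝ, ℝ) 2 (w L k)) (hε : ∀ L k, 0 < ε L k)
    (hε0 : ∀ L, Tendsto (ε L) atTop (𝓝 0))
    (hψ : ∀ L k x, ψ L k x = Real.sqrt (gradNorm (g L) (w L k) x ^ 2 + ε L k ^ 2))
    (hψ1 : ∀ L k, ContMDiffOn (𝓡 3) 𝓘(ℝ, ℝ) 1 (ψ L k) (U L \ closure E₀))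
    (hpde : ∀ L k, ∀ x ∈ U L \ closure E₀, ψ L k x * (ofRiemannian (g L)).dalembertian (w L k) x -
      (ofRiemannian (g L)).innerDual x (mvfderiv (𝓡 3) (ψ L k) x).toLinearMap
        (mvfderiv (𝓡 3) (w L k) x).toLinearMap = ψ L k x ^ 3)
    (hgradL : ∀ L, ∀ x ∈ U L \ closure E₀, ∃ C : ℝ≥0, ∃ V ∈ 𝓝 x, ∀ k, ∀ q ∈ V,
      gradNorm (g L) (w L k) q ≤ C)
    (hgradg : ∀ x, x ∉ closure E₀ → ∃ C : ℝ≥0, ∃ V ∈ 𝓝 x, ∃ L₀ : ℕ, ∀ L, L₀ ≤ L → ∀ k,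
      ∀ q ∈ V, gradNorm (g L) (w L k) q ≤ C)
    (hblip : letI : RiemannianBundle (fun x : X ↦ TangentSpace (𝓡 3) x) :=
        ⟨h.toContinuousRiemannianMetric.toRiemannianMetric⟩
      letI : PseudoEMetricSpace X := .ofRiemannianMetric (𝓡 3) X
      ∀ x ∈ frontier E₀, ∃ K : ℝ≥0, ∃ V ∈ 𝓝 x, ∀ L k, LipschitzOnWith K (w L k) (V ∩ E₀ᶜ))
    (hzero : ∀ L k, ∀ x ∈ frontier E₀, w L k x = 0)
    (hη : ∀ L, Tendsto (η L) atTop (𝓝 0)) (hlow : ∀ L k, ∀ x ∈ U L, x ∉ E₀ → -η L k ≤ w L k x)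
    (hup : ∀ x, x ∉ E₀ → ∃ B : ℝ, ∀ L k, x ∈ U L → w L k x ≤ B)
    (hbar : ∀ L, ∀ δ : ℝ, 0 < δ → ∃ C : Set X, IsCompact C ∧ C ⊆ U L ∧
      ∀ k, ∀ x ∈ U L, x ∉ C → b L - δ ≤ w L k x) :
    ∃ u₀ : X → ℝ, IsLocLipschitzOn h u₀ E₀ᶜ ∧ (∀ x ∈ frontier E₀, u₀ x = 0) ∧
      (∀ x ∈ E₀ᶜ, 0 ≤ u₀ x) ∧ (∀ t : ℝ, IsCompact {x | x ∈ E₀ᶜ ∧ u₀ x ≤ t}) ∧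
      IsWeakSolution h u₀ (closure E₀)ᶜ := by
  classical
  letI : RiemannianBundle (fun x : X ↦ TangentSpace (𝓡 3) x) :=
    ⟨h.toContinuousRiemannianMetric.toRiemannianMetric⟩
  letI : PseudoEMetricSpace X := .ofRiemannianMetric (𝓡 3) X
  set Ωi : Set X := (closure E₀)ᶜ with hΩidef
  have hΩio : IsOpen Ωi := isClosed_closure.isOpen_compl
  have hfront : frontier E₀ = closure E₀ \ E₀ := by rw [frontier, hE₀.interior_eq]
  have hfrontE : ∀ x ∈ frontier E₀, x ∉ E₀ := fun x hx ↦ (hfront ▸ hx).2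
  have hdecomp : ∀ x, x ∉ E₀ → x ∈ Ωi ∨ x ∈ frontier E₀ := fun x hxE ↦ by
    by_cases hxc : x ∈ closure E₀
    · exact Or.inr (hfront ▸ ⟨hxc, hxE⟩)
    · exact Or.inl hxc
  have hΩiE : Ωi ⊆ E₀ᶜ := fun x hx hxE ↦ hx (subset_closure hxE)
  have hvc : Continuous v := hv.continuous h
  have hF₀eq : F₀ = {x | v x < 0} := hv.2.1
  -- (0a) gradient bounds for `h` near the points of `Ωi`, eventually in `L` (`g_L = h` on `{v < c_L}`)
  have hgrad : ∀ x, x ∉ closure E₀ → ∃ C : ℝ≥0, ∃ V ∈ 𝓝 x, ∃ L₀ : ℕ, ∀ L, L₀ ≤ L → ∀ k,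
      ∀ q ∈ V, gradNorm h (w L k) q ≤ C := by
    intro x hx
    obtain ⟨C, V, hV, L₀, hC⟩ := hgradg x hx
    obtain ⟨L₁, hL₁⟩ := eventually_atTop.1 (hc.eventually_gt_atTop (v x + 1))
    have hVo : {y | v y < v x + 1} ∈ 𝓝 x := (isOpen_lt hvc continuous_const).mem_nhds (by
      simp only [mem_setOf_eq]; linarith)
    refine ⟨C, V ∩ {y | v y < v x + 1}, inter_mem hV hVo, max L₀ L₁, fun L hL k q hq ↦ ?_⟩
    have hqc : v q < c L := lt_trans hq.2 (hL₁ L (le_of_max_le_right hL))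
    rw [← gradNorm_congr_of_inner_eq (g L) h (hagree L q hqc) (w L k)]
    exact hC L (le_of_max_le_left hL) k q hq.1
  -- (0b) the comparison functions `v_L = min(v, c_L)` for the metrics `g_L`
  have hvLc : ∀ L, Continuous fun x ↦ min (v x) (c L) := fun L ↦ hvc.min continuous_const
  have hF₀L : ∀ L, F₀ = {x | min (v x) (c L) < 0} := fun L ↦ by
    rw [hF₀eq]; ext x; simp only [mem_setOf_eq, min_lt_iff, or_iff_left (not_lt.2 (hc0 L))]
  have hsubL' : ∀ L, IsWeakSubsolution (g L) (fun x ↦ min (min (v x) (c L)) (b L)) (closure F₀)ᶜ :=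
    fun L ↦ (hsubL L).inf_const (g L) isClosed_closure.isOpen_compl (b L)
  -- (0c) boundary Lipschitz bounds for the distances of the `g_L` (fixed `L`)
  have hblipL : ∀ L, letI : RiemannianBundle (fun x : X ↦ TangentSpace (𝓡 3) x) :=
        ⟨(g L).toContinuousRiemannianMetric.toRiemannianMetric⟩
      letI : PseudoEMetricSpace X := .ofRiemannianMetric (𝓡 3) X
      ∀ x ∈ frontier E₀, ∃ K : ℝ≥0, ∃ V ∈ 𝓝 x, ∀ k, LipschitzOnWith K (w L k) (V ∩ E₀ᶜ) := by
    intro L x hx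
    obtain ⟨K, V, hV, hK⟩ := hblip x hx
    obtain ⟨U', hU', c', hc'⟩ := exists_nhds_forall_lipschitzOnWith_of_metric h (g L) x
    exact ⟨K * c', V ∩ U', inter_mem hV hU', fun k ↦
      hc' (w L k) K (V ∩ U' ∩ E₀ᶜ) (fun y hy ↦ hy.1.2) ((hK L k).mono fun y hy ↦ ⟨hy.1.1, hy.2⟩)⟩
  -- (1) the fixed-`L` limits (on `(X, g_L)`)
  have part1 : ∀ L, ∃ (u : X → ℝ) (φ : ℕ → ℕ), StrictMono φ ∧
      TendstoLocallyUniformlyOn (fun n ↦ w L (φ n)) u atTop (U L ∩ E₀ᶜ) ∧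
      IsWeakSolution (g L) u (U L \ closure E₀) ∧ (∀ x ∈ frontier E₀, u x = 0) ∧
      (∀ x ∈ U L, x ∉ E₀ → 0 ≤ u x) ∧
      ∀ x ∈ U L \ closure E₀, min (min (v x) (c L)) (b L) ≤ u x := by
    intro L
    refine exists_isWeakSolution_ge_of_regularised_dirichlet' (g L) hE₀ (hUo L) (hE₀U L)
      (v := fun x ↦ min (v x) (c L)) (hvLc L) (hF₀L L) (hsubL' L) hE₀F₀
      (hw L) (hε L) (hε0 L) (hψ L) (hψ1 L) (hpde L) (hgradL L) (hblipL L) (hzero L) (hη L)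
      (hlow L) (fun x hxU hxE ↦ ?_) (hbar L)
    obtain ⟨B, hB⟩ := hup x hxE
    exact ⟨B, fun k ↦ hB L k hxU⟩
  choose uL φL hφL hconvL hsolg hzeroL hnnL hgeL using part1
  -- the `u_L` solve (1.5) for `h` on `Ω_L = (U_L ∖ Ē₀) ∩ {v < c_L}`, where `g_L = h`
  have hΩLo : ∀ L, IsOpen ((U L \ closure E₀) ∩ {x | v x < c L}) := fun L ↦
    ((hUo L).sdiff isClosed_closure).inter (isOpen_lt hvc continuous_const)
  have hsolL : ∀ L, IsWeakSolution h (uL L) ((U L \ closure E₀) ∩ {x | v x < c L}) := fun L ↦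
    ((hsolg L).mono (g L) (hΩLo L) inter_subset_left).of_metric (g L) h (hΩLo L)
      fun x hx ↦ hagree L x hx.2
  -- (2) truncate to `0` off `U L`
  set uh : ℕ → X → ℝ := fun L x ↦ if x ∈ U L then uL L x else 0 with huh
  have huhU : ∀ L, ∀ x ∈ U L, uh L x = uL L x := fun L x hx ↦ by simp only [huh, if_pos hx]
  have hsol' : ∀ L, IsWeakSolution h (uh L) ((U L \ closure E₀) ∩ {x | v x < c L}) := fun L ↦
    (hsolL L).congr h (hΩLo L) fun x hx ↦ (huhU L x hx.1.1).symm
  have hconv' : ∀ L, TendstoLocallyUniformlyOn (fun n ↦ w L (φL L n)) (uh L) atTop (U L ∩ E₀ᶜ) :=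
    fun L ↦ (hconvL L).congr_right fun x hx ↦ (huhU L x hx.1).symm
  have hpt' : ∀ L, ∀ x ∈ U L ∩ E₀ᶜ, Tendsto (fun n ↦ w L (φL L n) x) atTop (𝓝 (uh L x)) :=
    fun L x hx ↦ (hconv' L).tendsto_at hx
  have hzero' : ∀ L, ∀ x ∈ frontier E₀, uh L x = 0 := fun L x hx ↦ by
    rw [huhU L x (hE₀U L (frontier_subset_closure hx))]; exact hzeroL L x hx
  have hnn' : ∀ L x, x ∉ E₀ → 0 ≤ uh L x := fun L x hxE ↦ by
    by_cases hxU : x ∈ U L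
    · rw [huhU L x hxU]; exact hnnL L x hxU hxE
    · simp only [huh, if_neg hxU]; exact le_rfl
  have hup' : ∀ x, x ∉ E₀ → ∃ B : ℝ, 0 ≤ B ∧ ∀ L, uh L x ≤ B := by
    intro x hxE
    obtain ⟨B, hB⟩ := hup x hxE
    refine ⟨max B 0, le_max_right _ _, fun L ↦ ?_⟩
    by_cases hxU : x ∈ U L
    · exact (le_of_tendsto' (hpt' L x ⟨hxU, hxE⟩) fun n ↦ hB L _ hxU).trans (le_max_left _ _)
    · simp only [huh, if_neg hxU]; exact le_max_right _ _
  -- (3) equi-Lipschitz bounds for `(uh L)`, eventually in `L`, near the points of `Ωi`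
  have hlipΩ : ∀ x ∈ Ωi, ∃ K : ℝ≥0, ∃ W ∈ 𝓝 x, W ⊆ Ωi ∧
      ∀ᶠ L in atTop, LipschitzOnWith K (uh L) W := by
    intro x hx
    obtain ⟨C, V, hV, L₀, hC⟩ := hgrad x hx
    obtain ⟨N, hN, hNx⟩ := exists_compact_mem_nhds x
    obtain ⟨L₁, hL₁⟩ := hexh N hN
    obtain ⟨W, hW, hWV, c, hc⟩ := exists_nhds_subset_forall_lipschitzOnWith_of_gradNorm_le h x
      (inter_mem (inter_mem hV (hΩio.mem_nhds hx)) (interior_mem_nhds.2 hNx))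
    refine ⟨C * c, W, hW, fun y hy ↦ (hWV hy).1.2, ?_⟩
    filter_upwards [eventually_ge_atTop (max L₀ L₁)] with L hL
    have hWU : W ⊆ U L := fun y hy ↦
      hUmono L₁ L (le_of_max_le_right hL) (hL₁ (interior_subset (hWV hy).2))
    have hwk : ∀ k, LipschitzOnWith (C * c) (w L k) W := fun k ↦
      hc (w L k) C (fun q _ ↦ ((hw L k).of_le (by norm_num)).mdifferentiableAt one_ne_zero)
        fun q hq ↦ hC L (le_of_max_le_left hL) k q (hWV hq).1.1
    exact lipschitzOnWith_of_tendsto (Eventually.of_forall fun n ↦ hwk (φL L n))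
      fun y hy ↦ hpt' L y ⟨hWU hy, hΩiE (hWV hy).1.2⟩
  -- (4) equi-Lipschitz bounds near `∂E₀`, eventually in `L`, on relative neighbourhoods in `E₀ᶜ`
  have hlipB : ∀ x ∈ frontier E₀, ∃ K : ℝ≥0, ∃ W ∈ 𝓝 x,
      ∀ᶠ L in atTop, LipschitzOnWith K (uh L) (W ∩ E₀ᶜ) := by
    intro x hx
    obtain ⟨K, V, hV, hK⟩ := hblip x hx
    obtain ⟨N, hN, hNx⟩ := exists_compact_mem_nhds x
    obtain ⟨L₁, hL₁⟩ := hexh N hN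
    refine ⟨K, V ∩ interior N, inter_mem hV (interior_mem_nhds.2 hNx), ?_⟩
    filter_upwards [eventually_ge_atTop L₁] with L hL
    have hWU : V ∩ interior N ⊆ U L := fun y hy ↦ hUmono L₁ L hL (hL₁ (interior_subset hy.2))
    exact lipschitzOnWith_of_tendsto
      (Eventually.of_forall fun n ↦ (hK L (φL L n)).mono fun y hy ↦ ⟨hy.1.1, hy.2⟩)
      fun y hy ↦ hpt' L y ⟨hWU hy.1, hy.2⟩
  -- (5) Arzelà–Ascoli over `L` on `Ωi`
  obtain ⟨Λ, u₁, hΛ, hconvΩ⟩ :=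
    exists_strictMono_tendstoLocallyUniformlyOn_of_eventually_lipschitzOnWith h hΩio
      (fun x hx ↦ by
        obtain ⟨K, W, hW, -, hK⟩ := hlipΩ x hx
        exact ⟨K, W, hW, hK⟩)
      (fun x hx ↦ by
        obtain ⟨B, hB0, hB⟩ := hup' x (hΩiE hx)
        exact ⟨B, fun L ↦ abs_le.2 ⟨by linarith [hnn' L x (hΩiE hx)], hB L⟩⟩)
  set u : X → ℝ := fun x ↦ if x ∈ Ωi then u₁ x else 0 with hudef
  have huΩ : ∀ x ∈ Ωi, u x = u₁ x := fun x hx ↦ by simp only [hudef, if_pos hx]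
  have hu0 : ∀ x ∈ frontier E₀, u x = 0 := fun x hx ↦ by
    have : x ∉ Ωi := fun h' ↦ h' (frontier_subset_closure hx)
    simp only [hudef, if_neg this]
  have hconv : TendstoLocallyUniformlyOn (fun j ↦ uh (Λ j)) u atTop Ωi :=
    hconvΩ.congr_right fun x hx ↦ (huΩ x hx).symm
  have hΛev : ∀ {p : ℕ → Prop}, (∀ᶠ L in atTop, p L) → ∀ᶠ j in atTop, p (Λ j) := fun hp ↦
    hΛ.tendsto_atTop.eventually hp
  have hpt : ∀ x, x ∉ E₀ → Tendsto (fun j ↦ uh (Λ j) x) atTop (𝓝 (u x)) := by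
    intro x hxE
    rcases hdecomp x hxE with hxΩ | hxf
    · exact hconv.tendsto_at hxΩ
    · rw [hu0 x hxf]
      exact tendsto_const_nhds.congr fun j ↦ (hzero' (Λ j) x hxf).symm
  -- (6) the Compactness Theorem 2.1 along `L = Λ j → ∞`
  have hsol : IsWeakSolution h u Ωi := by
    refine isWeakSolution_of_tendstoLocallyUniformlyOn h hΩio
      (fun j ↦ hΩLo (Λ j)) (fun j ↦ hsol' (Λ j)) (fun K hK hKΩ ↦ ?_)
      hconv fun x hx ↦ ?_
    · obtain ⟨L₂, hL₂⟩ := hexh K hK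
      obtain ⟨M, hM⟩ := hK.bddAbove_image hvc.continuousOn
      filter_upwards [eventually_ge_atTop L₂, hΛev (hc.eventually_gt_atTop M)] with j hj hjc
      exact fun y hy ↦ ⟨⟨hUmono L₂ (Λ j) (hj.trans (hΛ.id_le j)) (hL₂ hy), hKΩ hy⟩,
        lt_of_le_of_lt (hM (mem_image_of_mem v hy)) hjc⟩
    · obtain ⟨K, W, hW, -, hK⟩ := hlipΩ x hx
      exact ⟨K, W, hW, hΛev hK⟩
  -- (7) the properties of the exterior solution
  have hnonneg : ∀ x ∈ E₀ᶜ, 0 ≤ u x := fun x hxE ↦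
    ge_of_tendsto' (hpt x hxE) fun j ↦ hnn' (Λ j) x hxE
  have hge : ∀ x ∈ E₀ᶜ, v x ≤ u x := by
    intro x hxE
    rcases hdecomp x hxE with hxΩ | hxf
    · obtain ⟨L₁, hL₁⟩ := hexh {x} isCompact_singleton
      have hev : ∀ᶠ L in atTop, v x ≤ uh L x := by
        filter_upwards [eventually_ge_atTop L₁, hb.eventually_ge_atTop (v x),
          hc.eventually_ge_atTop (v x)] with L hL hbL hcL
        have hxU : x ∈ U L := hUmono L₁ L hL (hL₁ rfl)
        rw [huhU L x hxU]
        have := hgeL L x ⟨hxU, hxΩ⟩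
        rwa [min_eq_left hcL, min_eq_left hbL] at this
      exact ge_of_tendsto (hpt x hxE) (hΛev hev)
    · have hxF : x ∈ F₀ := hE₀F₀ (frontier_subset_closure hxf)
      rw [hF₀eq] at hxF
      rw [hu0 x hxf]
      exact le_of_lt hxF
  have hlip : IsLocLipschitzOn h u E₀ᶜ := by
    intro x hxE
    rcases hdecomp x hxE with hxΩ | hxf
    · obtain ⟨K, W, hW, hWΩ, hK⟩ := hlipΩ x hxΩ
      refine ⟨K, W, mem_nhdsWithin_of_mem_nhds hW, ?_⟩
      exact lipschitzOnWith_of_tendsto (hΛev hK) fun y hy ↦ hpt y (hΩiE (hWΩ hy))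
    · obtain ⟨K, W, hW, hK⟩ := hlipB x hxf
      refine ⟨K, E₀ᶜ ∩ W, inter_mem_nhdsWithin _ hW, ?_⟩
      refine lipschitzOnWith_of_tendsto (f := fun j ↦ uh (Λ j)) ?_ fun y hy ↦ hpt y hy.1
      filter_upwards [hΛev hK] with j hj
      exact hj.mono fun y hy ↦ ⟨hy.2, hy.1⟩
  have hcont : ContinuousOn u E₀ᶜ := hlip.continuousOn h
  refine ⟨u, hlip, hu0, hnonneg, fun t ↦ ?_, hsol⟩
  exact isCompact_sep_le_of_le hE₀.isClosed_compl hvp (hF₀eq ▸ hF₀) hcont hge t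


/-! ### The named fact from the step-2 package -/

/-- **`weak_existence` from the elliptic regularisation for the modified metrics** (the analytic
package of Huisken–Ilmanen's proof of Thm. 3.1 in the form of its step 2). For every datum of the
fact and every normalised subsolution `v` (`Ē₀ ⊆ F₀`) suppose given: levels `c_L ≥ 0`,
`c_L → ∞`; smooth metrics `g_L ≥ h` on `X` with Levi-Civita connections and `g_L = h` on
`{v < c_L}`; an increasing exhaustion `U_L ⊇ Ē₀` of `X` by open sets; and classical solutions
`w_{L,k} ∈ C²(X)` of (⋆)_{ε_{L,k}} *for `g_L`* on `U_L ∖ Ē₀`, `ε_{L,k} → 0`, with the estimates of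
Lemma 3.4 — local gradient bounds (for `g_L`) uniform in `k` on `U_L ∖ Ē₀` and uniform in
`(L, k)` eventually near each point of `X ∖ Ē₀`, Lipschitz bounds near `∂E₀` (for `d_h`) and
`w = 0` on `∂E₀`, `w ≥ −η_{L,k} → 0`, the sup bound `w_{L,k} ≤ B_L`, and the lower barrier
`w ≥ b_L − δ` off compact subsets of `U_L`, `b_L → ∞`. Then `weak_existence` holds.
(`min(v, c_L)` is a weak subsolution for `g_L` by `IsWeakSubsolutionIVP.inf_const_of_metric_le`;
pointwise bounds uniform in `L` by `exists_forall_abs_le_of_lipschitz_chain`; then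
`exterior_existence_of_regularised_dirichlet_solutions_metric` and
`weak_existence_of_exterior_existence`.) What this leaves is the construction of `g_L` (the conic
modification near `∂U_L`) and the Hölder-space theory of (⋆)_ε for `g_L` (Lemmas 3.4–3.5).
[cite: HuiskenIlmanenIMCF2001, Thm. 3.1 (proof, step 2), Lemmas 3.4–3.5] -/
theorem weak_existence_of_regularised_dirichlet_solutions_metric
    (H : ∀ (X : Type) [TopologicalSpace X] [ChartedSpace E3 X] [IsManifold (𝓡 3) ∞ X]
      [T2Space X] [SecondCountableTopology X] [LocallyCompactSpace X] [ConnectedSpace X]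
      [NoncompactSpace X] [MeasurableSpace X] [BorelSpace X]
      (h : ContMDiffRiemannianMetric (𝓡 3) ∞ E3 (TangentSpace (𝓡 3) : X → Type _))
      [(ofRiemannian h).HasLeviCivita],
      IsGeodesicallyComplete (ofRiemannian h).leviCivita →
      ∀ (E₀ F₀ : Set X) (v : X → ℝ), E₀.Nonempty → IsSmoothPrecompactOpen E₀ →
        IsWeakSubsolutionIVP h v F₀ → IsProperFun v → IsCompact (closure F₀) → closure E₀ ⊆ F₀ →
        ∃ (c : ℕ → ℝ) (g : ℕ → ContMDiffRiemannianMetric (𝓡 3) ∞ E3 (TangentSpace (𝓡 3) : X → Type _))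
          (_ : ∀ L, (ofRiemannian (g L)).HasLeviCivita)
          (U : ℕ → Set X) (w : ℕ → ℕ → X → ℝ) (ε : ℕ → ℕ → ℝ) (ψ : ℕ → ℕ → X → ℝ)
          (η : ℕ → ℕ → ℝ) (b : ℕ → ℝ),
          (∀ L, 0 ≤ c L) ∧ Tendsto c atTop atTop ∧
          (∀ L (x : X) (ξ : TangentSpace (𝓡 3) x), h.inner x ξ ξ ≤ (g L).inner x ξ ξ) ∧
          (∀ L x, v x < c L → h.inner x = (g L).inner x) ∧
          (∀ L, IsOpen (U L)) ∧ (∀ L, closure E₀ ⊆ U L) ∧ (∀ L M : ℕ, L ≤ M → U L ⊆ U M) ∧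
          (∀ K : Set X, IsCompact K → ∃ L, K ⊆ U L) ∧ Tendsto b atTop atTop ∧
          (∀ L k, ContMDiff (𝓡 3) 𝓘(ℝ, ℝ) 2 (w L k)) ∧ (∀ L k, 0 < ε L k) ∧
          (∀ L, Tendsto (ε L) atTop (𝓝 0)) ∧
          (∀ L k x, ψ L k x = Real.sqrt (gradNorm (g L) (w L k) x ^ 2 + ε L k ^ 2)) ∧
          (∀ L k, ContMDiffOn (𝓡 3) 𝓘(ℝ, ℝ) 1 (ψ L k) (U L \ closure E₀)) ∧
          (∀ L k, ∀ x ∈ U L \ closure E₀, ψ L k x * (ofRiemannian (g L)).dalembertian (w L k) x -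
            (ofRiemannian (g L)).innerDual x (mvfderiv (𝓡 3) (ψ L k) x).toLinearMap
              (mvfderiv (𝓡 3) (w L k) x).toLinearMap = ψ L k x ^ 3) ∧
          (∀ L, ∀ x ∈ U L \ closure E₀, ∃ C : ℝ≥0, ∃ V ∈ 𝓝 x, ∀ k, ∀ q ∈ V,
            gradNorm (g L) (w L k) q ≤ C) ∧
          (∀ x, x ∉ closure E₀ → ∃ C : ℝ≥0, ∃ V ∈ 𝓝 x, ∃ L₀ : ℕ, ∀ L, L₀ ≤ L → ∀ k, ∀ q ∈ V,
            gradNorm (g L) (w L k) q ≤ C) ∧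
          (letI : RiemannianBundle (fun x : X ↦ TangentSpace (𝓡 3) x) :=
              ⟨h.toContinuousRiemannianMetric.toRiemannianMetric⟩;
            letI : PseudoEMetricSpace X := .ofRiemannianMetric (𝓡 3) X;
            ∀ x ∈ frontier E₀, ∃ K : ℝ≥0, ∃ V ∈ 𝓝 x, ∀ L k,
              LipschitzOnWith K (w L k) (V ∩ E₀ᶜ)) ∧
          (∀ L k, ∀ x ∈ frontier E₀, w L k x = 0) ∧
          (∀ L, Tendsto (η L) atTop (𝓝 0)) ∧ (∀ L k, ∀ x ∈ U L, x ∉ E₀ → -η L k ≤ w L k x) ∧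
          (∀ L, ∃ B : ℝ, ∀ k, ∀ x ∈ U L, x ∉ E₀ → w L k x ≤ B) ∧
          (∀ L, ∀ δ : ℝ, 0 < δ → ∃ C : Set X, IsCompact C ∧ C ⊆ U L ∧
            ∀ k, ∀ x ∈ U L, x ∉ C → b L - δ ≤ w L k x)) :
    weak_existence := by
  refine weak_existence_of_exterior_existence
    fun X _ _ _ _ _ _ _ _ _ _ h _ hcomplete hsub E₀ hne hE₀ ↦ ?_
  obtain ⟨v, F₀, hvp, hF₀, hv, hE₀F₀⟩ := exists_isWeakSubsolutionIVP_closure_subset h hsub hE₀.2.1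
  obtain ⟨c, g, hLC, U, w, ε, ψ, η, b, hc0, hc, hle, hagree, hUo, hE₀U, hUmono, hexh, hb, hw, hε,
    hε0, hψ, hψ1, hpde, hgradL, hgradg, hblip, hzero, hη, hlow, hupL, hbar⟩ :=
    H X h hcomplete E₀ F₀ v hne hE₀ hv hvp hF₀ hE₀F₀
  haveI := hLC
  have hvc : Continuous v := hv.continuous h
  -- `min(v, c_L)` is a weak subsolution for `g_L`
  have hsubL : ∀ L, IsWeakSubsolution (g L) (fun x ↦ min (v x) (c L)) (closure F₀)ᶜ := fun L ↦
    hv.inf_const_of_metric_le h (g L) (c L) (hle L) (hagree L)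
  -- gradient bounds for `h` near the points of `X ∖ Ē₀`, eventually in `L`, for the chaining
  have hgrad : ∀ x, x ∉ closure E₀ → ∃ C : ℝ≥0, ∃ V ∈ 𝓝 x, ∃ L₀ : ℕ, ∀ L, L₀ ≤ L → ∀ k,
      ∀ q ∈ V, gradNorm h (w L k) q ≤ C := by
    intro x hx
    obtain ⟨C, V, hV, L₀, hC⟩ := hgradg x hx
    obtain ⟨L₁, hL₁⟩ := eventually_atTop.1 (hc.eventually_gt_atTop (v x + 1))
    have hVo : {y | v y < v x + 1} ∈ 𝓝 x := (isOpen_lt hvc continuous_const).mem_nhds (by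
      simp only [mem_setOf_eq]; linarith)
    refine ⟨C, V ∩ {y | v y < v x + 1}, inter_mem hV hVo, max L₀ L₁, fun L hL k q hq ↦ ?_⟩
    have hqc : v q < c L := lt_trans hq.2 (hL₁ L (le_of_max_le_right hL))
    rw [gradNorm_congr_of_inner_eq h (g L) (hagree L q hqc) (w L k)]
    exact hC L (le_of_max_le_left hL) k q hq.1
  -- pointwise upper bounds uniform in `(L, k)`: chaining for `L ≥ L₀`, the sup bounds below `L₀`
  have hup : ∀ x, x ∉ E₀ → ∃ B : ℝ, ∀ L k, x ∈ U L → w L k x ≤ B := by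
    intro x hxE
    obtain ⟨B, L₀, hB⟩ := exists_forall_abs_le_of_lipschitz_chain h hE₀.1 hne
      (fun L k ↦ (hw L k).of_le (by norm_num)) hgrad hblip hzero x hxE
    choose Bf hBf using hupL
    refine ⟨max B (∑ L ∈ Finset.range L₀, |Bf L|), fun L k hxU ↦ ?_⟩
    by_cases hL : L₀ ≤ L
    · exact ((le_abs_self _).trans (hB L hL k)).trans (le_max_left _ _)
    · have hLr : L ∈ Finset.range L₀ := Finset.mem_range.2 (not_le.1 hL)
      calc w L k x ≤ Bf L := hBf L k x hxU hxE
        _ ≤ |Bf L| := le_abs_self _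
        _ ≤ ∑ L ∈ Finset.range L₀, |Bf L| :=
            Finset.single_le_sum (fun i _ ↦ abs_nonneg (Bf i)) hLr
        _ ≤ max B (∑ L ∈ Finset.range L₀, |Bf L|) := le_max_right _ _
  exact exterior_existence_of_regularised_dirichlet_solutions_metric h hE₀.1 hv hvp hF₀ hE₀F₀ g
    hc0 hc (fun L x hx ↦ (hagree L x hx).symm) hsubL hUo hE₀U hUmono hexh hb hw hε hε0 hψ hψ1
    hpde hgradL hgradg hblip hzero hη hlow hup hbar

end Literature.Geometry.Lorentzian

end
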